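import Literature.Geometry.GeometricMeasureTheory.RadialProfiles
import Mathlib.MeasureTheory.Integral.Lebesgue.DominatedConvergence
import Mathlib.MeasureTheory.Measure.WithDensity
import Mathlib.MeasureTheory.Measure.Prod
import Mathlib.MeasureTheory.Integral.Bochner.Set
import Mathlib.Analysis.SpecialFunctions.Log.Basic
import Mathlib.Analysis.SpecialFunctions.Integrals.Basic
import HarnessLib

/-!
# Density of a measure at a point from the profile-invariance of its Monge–Ampère functionals

The measure-theoretic ("Tauberian") core of the computation of the Lelong number of an analytic
set by Monge–Ampère integrals of radial weights ([Chirka1989, §15.1 Prop. 1–2]; [Demailly,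
*Complex analytic and differential geometry*, Ch. III (5.5)–(5.6), Thm. 7.7]), isolated from the
geometry. Let `μ` be a finite measure on a measurable space `X`, `rad : X → (0, ∞)` ("distance to
the centre") and `σ : X → [0, 1]` ("tangential fraction") measurable, `p ≥ 1`. For a profile
transition `h` (`RadialProfiles.lean`) the **profile functional** is
`Φ(h) = ∫ rad^{-2p} (h(log rad)^p (1 - σ) + ½ h^{p-1} h'(log rad) σ) dμ` — for
`μ = 𝓗^{2p} ⌞ A` and `σ(z) = |pr_{T_z A} z|²/|z|²` this is, up to the factor `p! 2^p`, the
Monge–Ampère mass `∫_A (dd^c g(log|z|))^p`, `g' = h`, and Stokes' theorem makes it independent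
of the profile. **Theorem** (`tendsto_measure_div_pow_of_profile_invariance`): if `Φ(h) = L < ∞`
for every transition `h` located left of `x₀`, then

* `W = ∫ rad^{-2p} (1 - σ) dμ ≤ L` (`lintegral_inv_pow_mul_one_sub_le`), and
* `μ {rad < r} / r^{2p} → L - W` as `r → 0⁺`.

Proof: positivity gives `W ≤ L` by monotone convergence; translating a fixed transition to `-∞`
the kernel part `Θ(s) = ∫ rad^{-2p} ½h^{p-1}h'(log rad - s) dμ` tends to `L - W`; on the support
of the kernel `rad^{-2p} ≍ e^{-2ps}` within `e^{±2pε}`, and integrating the kernel in `s` over a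
window (Tonelli and `∫ ½ h^{p-1} h' = h^p/(2p)`) sandwiches `μ{rad < r}` between
`(L - W ∓ η) e^{∓4pε} r^{2p}`; finally `ε, η → 0`.

Theorems only; imports `RadialProfiles.lean` and Mathlib.

## References

* E. M. Chirka, *Complex Analytic Sets*, Kluwer 1989, §15.1 [Chirka1989].
* J.-P. Demailly, *Complex analytic and differential geometry*, Ch. III §5, §7.
-/

noncomputable section

open Set Filter MeasureTheory intervalIntegral Real
open scoped Topology ENNReal

namespace Literature.Geometry.GeometricMeasureTheory

variable {X : Type*} {rad σ : X → ℝ} {p : ℕ} {x₀ : ℝ} {L : ℝ≥0∞}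

/-! ### Pointwise facts about the profile integrand -/

section Pointwise

variable {h : ℝ → ℝ} {s ε : ℝ}

/-- The profile integrand is non-negative. [folklore] -/
theorem profileIntegrand_nonneg (hh : IsProfileTransition h s ε) (hσ0 : ∀ x, 0 ≤ σ x)
    (hσ1 : ∀ x, σ x ≤ 1) (hrad : ∀ x, 0 < rad x) (x : X) :
    0 ≤ (rad x ^ (2 * p))⁻¹ *
      (h (log (rad x)) ^ p * (1 - σ x) + profileKernel h p (log (rad x)) * σ x) := by
  have h1 : 0 ≤ h (log (rad x)) ^ p * (1 - σ x) :=
    mul_nonneg (pow_nonneg (hh.nonneg _) _) (by linarith [hσ1 x])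
  have h2 : 0 ≤ profileKernel h p (log (rad x)) * σ x :=
    mul_nonneg (hh.profileKernel_nonneg p _) (hσ0 x)
  have h3 : 0 ≤ (rad x ^ (2 * p))⁻¹ := inv_nonneg.2 (pow_nonneg (hrad x).le _)
  positivity

/-- Splitting the profile integrand into its `(1 - σ)`-part and its kernel part, in `ℝ≥0∞`.
[folklore] -/
theorem ofReal_profileIntegrand_eq_add (hh : IsProfileTransition h s ε) (hσ0 : ∀ x, 0 ≤ σ x)
    (hσ1 : ∀ x, σ x ≤ 1) (hrad : ∀ x, 0 < rad x) (x : X) :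
    ENNReal.ofReal ((rad x ^ (2 * p))⁻¹ *
        (h (log (rad x)) ^ p * (1 - σ x) + profileKernel h p (log (rad x)) * σ x)) =
      ENNReal.ofReal ((rad x ^ (2 * p))⁻¹ * (h (log (rad x)) ^ p * (1 - σ x))) +
        ENNReal.ofReal ((rad x ^ (2 * p))⁻¹ * (profileKernel h p (log (rad x)) * σ x)) := by
  rw [mul_add, ENNReal.ofReal_add]
  · exact mul_nonneg (inv_nonneg.2 (pow_nonneg (hrad x).le _))
      (mul_nonneg (pow_nonneg (hh.nonneg _) _) (by linarith [hσ1 x]))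
  · exact mul_nonneg (inv_nonneg.2 (pow_nonneg (hrad x).le _))
      (mul_nonneg (hh.profileKernel_nonneg p _) (hσ0 x))

/-- On `{log rad ≥ s + ε}` the `(1 - σ)`-part of the integrand is `rad^{-2p}(1 - σ)`. [folklore] -/
theorem profileIntegrand_fst_eq_of_le (hh : IsProfileTransition h s ε) {x : X}
    (hx : s + ε ≤ log (rad x)) :
    (rad x ^ (2 * p))⁻¹ * (h (log (rad x)) ^ p * (1 - σ x)) = (rad x ^ (2 * p))⁻¹ * (1 - σ x) := by
  rw [hh.eq_one_of_le _ hx, one_pow, one_mul]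

/-- The `(1 - σ)`-part of the integrand is at most `rad^{-2p}(1 - σ)`. [folklore] -/
theorem profileIntegrand_fst_le (hh : IsProfileTransition h s ε) (hσ1 : ∀ x, σ x ≤ 1)
    (hrad : ∀ x, 0 < rad x) (x : X) :
    (rad x ^ (2 * p))⁻¹ * (h (log (rad x)) ^ p * (1 - σ x)) ≤ (rad x ^ (2 * p))⁻¹ * (1 - σ x) := by
  have h3 : 0 ≤ (rad x ^ (2 * p))⁻¹ := inv_nonneg.2 (pow_nonneg (hrad x).le _)
  apply mul_le_mul_of_nonneg_left _ h3
  have : h (log (rad x)) ^ p ≤ 1 := pow_le_one₀ (hh.nonneg _) (hh.le_one _)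
  nlinarith [hσ1 x]

/-- The kernel part with `σ` replaced by `1` exceeds the kernel part by at most
`B · rad^{-2p} (1 - σ) · 𝟙_{|log rad - s| < ε}`, `B` a bound of the kernel. [folklore] -/
theorem profileIntegrand_snd_one_sub_le (hh : IsProfileTransition h s ε) (hσ1 : ∀ x, σ x ≤ 1)
    (hrad : ∀ x, 0 < rad x) {B : ℝ} (hB : ∀ y, profileKernel h p y ≤ B) (x : X) :
    (rad x ^ (2 * p))⁻¹ * (profileKernel h p (log (rad x)) * (1 - σ x)) ≤
      B * ((rad x ^ (2 * p))⁻¹ * (1 - σ x)) *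
        ({x | |log (rad x) - s| < ε} : Set X).indicator (fun _ => (1 : ℝ)) x := by
  have h3 : 0 ≤ (rad x ^ (2 * p))⁻¹ := inv_nonneg.2 (pow_nonneg (hrad x).le _)
  have h4 : 0 ≤ 1 - σ x := by linarith [hσ1 x]
  by_cases hx : |log (rad x) - s| < ε
  · rw [indicator_of_mem (by exact hx), mul_one]
    calc (rad x ^ (2 * p))⁻¹ * (profileKernel h p (log (rad x)) * (1 - σ x))
        = profileKernel h p (log (rad x)) * ((rad x ^ (2 * p))⁻¹ * (1 - σ x)) := by ring
      _ ≤ B * ((rad x ^ (2 * p))⁻¹ * (1 - σ x)) :=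
        mul_le_mul_of_nonneg_right (hB _) (mul_nonneg h3 h4)
  · rw [indicator_of_notMem (by exact hx), mul_zero,
      hh.profileKernel_eq_zero_of_lt_abs p (not_lt.1 hx)]
    simp

/-- On the support of the translated kernel, `rad^{-2p}` is comparable to `e^{-2ps}`: upper bound.
[folklore] -/
theorem inv_pow_mul_kernel_le (hh : IsProfileTransition h 0 ε) (hrad : ∀ x, 0 < rad x)
    (s : ℝ) (x : X) :
    (rad x ^ (2 * p))⁻¹ * profileKernel h p (log (rad x) - s) ≤
      exp (-(2 * p) * (s - ε)) * profileKernel h p (log (rad x) - s) := by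
  by_cases hx : |log (rad x) - s| < ε
  · apply mul_le_mul_of_nonneg_right _ (hh.profileKernel_nonneg p _)
    have hr := hrad x
    rw [← rpow_natCast, ← exp_log hr, ← exp_mul, ← exp_neg]
    apply exp_le_exp.2
    have : s - ε < log (rad x) := by linarith [(abs_lt.1 hx).1]
    push_cast
    nlinarith
  · rw [hh.profileKernel_eq_zero_of_lt_abs p (by simpa using not_lt.1 hx)]
    simp

/-- On the support of the translated kernel, `rad^{-2p}` is comparable to `e^{-2ps}`: lower bound.
[folklore] -/
theorem exp_mul_kernel_le (hh : IsProfileTransition h 0 ε) (hrad : ∀ x, 0 < rad x)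
    (s : ℝ) (x : X) :
    exp (-(2 * p) * (s + ε)) * profileKernel h p (log (rad x) - s) ≤
      (rad x ^ (2 * p))⁻¹ * profileKernel h p (log (rad x) - s) := by
  by_cases hx : |log (rad x) - s| < ε
  · apply mul_le_mul_of_nonneg_right _ (hh.profileKernel_nonneg p _)
    have hr := hrad x
    rw [← rpow_natCast, ← exp_log hr, ← exp_mul, ← exp_neg]
    apply exp_le_exp.2
    have : log (rad x) < s + ε := by linarith [(abs_lt.1 hx).2]
    push_cast
    nlinarith
  · rw [hh.profileKernel_eq_zero_of_lt_abs p (by simpa using not_lt.1 hx)]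
    simp

end Pointwise

variable [MeasurableSpace X] {μ : Measure X}

/-! ### Measurability -/

section Measurability

variable {h : ℝ → ℝ} {s ε : ℝ}

/-- Measurability of `rad^{-2p}(1 - σ)`. [folklore] -/
theorem measurable_inv_pow_mul_one_sub (hradm : Measurable rad) (hσm : Measurable σ) :
    Measurable fun x => ENNReal.ofReal ((rad x ^ (2 * p))⁻¹ * (1 - σ x)) :=
  ENNReal.measurable_ofReal.comp (((hradm.pow_const _).inv).mul (measurable_const.sub hσm))

/-- Measurability of the `(1 - σ)`-part of the profile integrand. [folklore] -/
theorem measurable_profileIntegrand_fst (hh : IsProfileTransition h s ε) (hradm : Measurable rad)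
    (hσm : Measurable σ) :
    Measurable fun x => ENNReal.ofReal ((rad x ^ (2 * p))⁻¹ * (h (log (rad x)) ^ p * (1 - σ x))) :=
  ENNReal.measurable_ofReal.comp (((hradm.pow_const _).inv).mul
    (((hh.contDiff.continuous.measurable.comp (measurable_log.comp hradm)).pow_const _).mul
      (measurable_const.sub hσm)))

/-- Measurability of the kernel part of the profile integrand. [folklore] -/
theorem measurable_profileIntegrand_snd (hh : IsProfileTransition h s ε) (hradm : Measurable rad)
    (hσm : Measurable σ) :
    Measurable fun x =>
      ENNReal.ofReal ((rad x ^ (2 * p))⁻¹ * (profileKernel h p (log (rad x)) * σ x)) :=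
  ENNReal.measurable_ofReal.comp (((hradm.pow_const _).inv).mul
    (((hh.continuous_profileKernel p).measurable.comp (measurable_log.comp hradm)).mul hσm))

/-- Measurability of `rad^{-2p}` times a translated kernel. [folklore] -/
theorem measurable_inv_pow_mul_kernel (hh : IsProfileTransition h s ε) (hradm : Measurable rad)
    (c : ℝ) :
    Measurable fun x =>
      ENNReal.ofReal ((rad x ^ (2 * p))⁻¹ * profileKernel h p (log (rad x) - c)) :=
  ENNReal.measurable_ofReal.comp (((hradm.pow_const _).inv).mul
    ((hh.continuous_profileKernel p).measurable.comp ((measurable_log.comp hradm).sub_const c)))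

/-- Measurability of `{t ≤ log rad}`. [folklore] -/
theorem measurableSet_le_log (hradm : Measurable rad) (t : ℝ) :
    MeasurableSet {x | t ≤ log (rad x)} :=
  measurableSet_le measurable_const (measurable_log.comp hradm)

/-- Measurability of `{log rad < t}`. [folklore] -/
theorem measurableSet_log_lt (hradm : Measurable rad) (t : ℝ) :
    MeasurableSet {x | log (rad x) < t} :=
  measurableSet_lt (measurable_log.comp hradm) measurable_const

/-- Measurability of `{log rad ≤ t}`. [folklore] -/
theorem measurableSet_log_le (hradm : Measurable rad) (t : ℝ) :
    MeasurableSet {x | log (rad x) ≤ t} :=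
  measurableSet_le (measurable_log.comp hradm) measurable_const

end Measurability

/-! ### Step 1: `W ≤ L` -/

section Main

/-- For a transition located left of `x₀`, the part of `W` over `{log rad ≥ s + ε}` is at most `L`.
[folklore] -/
theorem setLIntegral_inv_pow_mul_one_sub_le (hradm : Measurable rad) (hrad : ∀ x, 0 < rad x)
    (hσ0 : ∀ x, 0 ≤ σ x) (hσ1 : ∀ x, σ x ≤ 1) {h : ℝ → ℝ} {s ε : ℝ}
    (hh : IsProfileTransition h s ε) (hε : 0 < ε) (hs : s + ε ≤ x₀)
    (H : ∀ (h : ℝ → ℝ) (s ε : ℝ), 0 < ε → s + ε ≤ x₀ → IsProfileTransition h s ε →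
      ∫⁻ x, ENNReal.ofReal ((rad x ^ (2 * p))⁻¹ *
        (h (log (rad x)) ^ p * (1 - σ x) + profileKernel h p (log (rad x)) * σ x)) ∂μ = L) :
    ∫⁻ x in {x | s + ε ≤ log (rad x)}, ENNReal.ofReal ((rad x ^ (2 * p))⁻¹ * (1 - σ x)) ∂μ ≤ L := by
  rw [← H h s ε hε hs hh, ← lintegral_indicator (measurableSet_le_log hradm _)]
  refine lintegral_mono fun x => ?_
  by_cases hx : x ∈ {x | s + ε ≤ log (rad x)}
  · rw [indicator_of_mem hx, ofReal_profileIntegrand_eq_add hh hσ0 hσ1 hrad,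
      ← profileIntegrand_fst_eq_of_le hh hx]
    exact le_self_add
  · rw [indicator_of_notMem hx]
    exact zero_le

/-- **Positivity step**: `W = ∫ rad^{-2p}(1 - σ) dμ ≤ L` (monotone convergence over the
transitions located at `s → -∞`). [cite: Chirka1989, §15.1] -/
theorem lintegral_inv_pow_mul_one_sub_le (hradm : Measurable rad) (hrad : ∀ x, 0 < rad x)
    (hσm : Measurable σ) (hσ0 : ∀ x, 0 ≤ σ x) (hσ1 : ∀ x, σ x ≤ 1)
    (H : ∀ (h : ℝ → ℝ) (s ε : ℝ), 0 < ε → s + ε ≤ x₀ → IsProfileTransition h s ε →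
      ∫⁻ x, ENNReal.ofReal ((rad x ^ (2 * p))⁻¹ *
        (h (log (rad x)) ^ p * (1 - σ x) + profileKernel h p (log (rad x)) * σ x)) ∂μ = L) :
    ∫⁻ x, ENNReal.ofReal ((rad x ^ (2 * p))⁻¹ * (1 - σ x)) ∂μ ≤ L := by
  set f : X → ℝ≥0∞ := fun x => ENNReal.ofReal ((rad x ^ (2 * p))⁻¹ * (1 - σ x)) with hf
  -- the increasing sets `S n = {log rad ≥ x₀ - n}` exhaust `X`
  set S : ℕ → Set X := fun n => {x | x₀ - n ≤ log (rad x)} with hS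
  have hSm : ∀ n, MeasurableSet (S n) := fun n => measurableSet_le_log hradm _
  have hmono : Monotone fun n => (S n).indicator f := by
    intro n m hnm x
    refine indicator_le_indicator_of_subset (fun y hy => ?_) (fun _ => zero_le) x
    simp only [hS, mem_setOf_eq] at hy ⊢
    have : (n : ℝ) ≤ m := by exact_mod_cast hnm
    linarith
  have hsup : ∀ x, f x = ⨆ n, (S n).indicator f x := by
    intro x
    apply le_antisymm
    · obtain ⟨n, hn⟩ := exists_nat_ge (x₀ - log (rad x))
      have hx : x ∈ S n := by simp only [hS, mem_setOf_eq]; linarith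
      exact le_iSup_of_le n (by rw [indicator_of_mem hx])
    · exact iSup_le fun n => indicator_le_self _ _ x
  calc ∫⁻ x, f x ∂μ = ∫⁻ x, ⨆ n, (S n).indicator f x ∂μ := lintegral_congr hsup
    _ = ⨆ n, ∫⁻ x, (S n).indicator f x ∂μ :=
        lintegral_iSup (fun n => (measurable_inv_pow_mul_one_sub hradm hσm).indicator (hSm n)) hmono
    _ ≤ L := iSup_le fun n => by
        rw [lintegral_indicator (hSm n)]
        obtain ⟨h, hh⟩ := exists_isProfileTransition (x₀ - n - 1) one_pos
        have hn : (0 : ℝ) ≤ n := n.cast_nonneg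
        have := setLIntegral_inv_pow_mul_one_sub_le hradm hrad hσ0 hσ1 hh one_pos (by linarith) H
        simpa [hS, sub_add_cancel] using this

/-! ### Step 2: the kernel functional `Θ(s)` tends to `L - W` as `s → -∞` -/

/-- The tails `∫_{log rad < t} rad^{-2p}(1 - σ) dμ` of the finite integral `W` tend to `0` as
`t → -∞`. [folklore] -/
theorem tendsto_setLIntegral_inv_pow_mul_one_sub_atBot (hradm : Measurable rad)
    (hσm : Measurable σ)
    (hW : ∫⁻ x, ENNReal.ofReal ((rad x ^ (2 * p))⁻¹ * (1 - σ x)) ∂μ ≠ ⊤) :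
    Tendsto (fun t => ∫⁻ x in {x | log (rad x) < t}, ENNReal.ofReal ((rad x ^ (2 * p))⁻¹ * (1 - σ x)) ∂μ)
      atBot (𝓝 0) := by
  set f : X → ℝ≥0∞ := fun x => ENNReal.ofReal ((rad x ^ (2 * p))⁻¹ * (1 - σ x)) with hf
  have hfm : Measurable f := measurable_inv_pow_mul_one_sub hradm hσm
  set ν : Measure X := μ.withDensity f with hν
  have hνD : ∀ t, ∫⁻ x in {x | log (rad x) < t}, f x ∂μ = ν {x | log (rad x) < t} := fun t => by
    rw [hν, withDensity_apply _ (measurableSet_log_lt hradm t)]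
  simp_rw [hνD]
  -- along the integers the sets decrease to `∅`
  have hanti : Antitone fun n : ℕ => {x : X | log (rad x) < -(n : ℝ)} := by
    intro n m hnm x hx
    simp only [mem_setOf_eq] at hx ⊢
    have : (n : ℝ) ≤ m := by exact_mod_cast hnm
    linarith
  have hfin : ν univ ≠ ⊤ := by
    rwa [hν, withDensity_apply _ MeasurableSet.univ, Measure.restrict_univ]
  have hlim := tendsto_measure_iInter_atTop (μ := ν)
    (s := fun n : ℕ => {x : X | log (rad x) < -(n : ℝ)})
    (fun n : ℕ => (measurableSet_log_lt hradm (-(n : ℝ))).nullMeasurableSet) hanti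
    ⟨0, ne_top_of_le_ne_top hfin (measure_mono (subset_univ _))⟩
  have hempty : (⋂ n : ℕ, {x : X | log (rad x) < -(n : ℝ)}) = ∅ := by
    ext x
    simp only [mem_iInter, mem_setOf_eq, mem_empty_iff_false, iff_false, not_forall, not_lt]
    obtain ⟨n, hn⟩ := exists_nat_ge (-log (rad x))
    exact ⟨n, by linarith⟩
  rw [hempty, measure_empty] at hlim
  rw [ENNReal.tendsto_nhds_zero]
  intro δ hδ
  obtain ⟨n, hn⟩ := (ENNReal.tendsto_nhds_zero.1 hlim δ hδ).exists
  filter_upwards [eventually_le_atBot (-(n : ℝ))] with t ht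
  exact (measure_mono fun x (hx : log (rad x) < t) => show log (rad x) < -(n : ℝ) by
    linarith).trans hn

/-- Translating a transition located at `0`. [folklore] -/
theorem IsProfileTransition.translate {h : ℝ → ℝ} {ε : ℝ} (hh : IsProfileTransition h 0 ε)
    (s : ℝ) : IsProfileTransition (fun x => h (x - s)) s ε := by
  simpa using hh.comp_sub s

/-- **The kernel functional tends to `L - W`**: for a fixed transition `h` at `0` of scale `ε`,
`Θ(s) = ∫ rad^{-2p} ½ h^{p-1} h'(log rad - s) dμ → L - W` as `s → -∞`, where
`W = ∫ rad^{-2p}(1 - σ) dμ`. [cite: Chirka1989, §15.1] -/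
theorem tendsto_lintegral_inv_pow_mul_kernel_atBot (hradm : Measurable rad) (hrad : ∀ x, 0 < rad x)
    (hσm : Measurable σ) (hσ0 : ∀ x, 0 ≤ σ x) (hσ1 : ∀ x, σ x ≤ 1) (hL : L ≠ ⊤)
    (H : ∀ (h : ℝ → ℝ) (s ε : ℝ), 0 < ε → s + ε ≤ x₀ → IsProfileTransition h s ε →
      ∫⁻ x, ENNReal.ofReal ((rad x ^ (2 * p))⁻¹ *
        (h (log (rad x)) ^ p * (1 - σ x) + profileKernel h p (log (rad x)) * σ x)) ∂μ = L)
    {h : ℝ → ℝ} {ε : ℝ} (hh : IsProfileTransition h 0 ε) (hε : 0 < ε) :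
    Tendsto (fun s => ∫⁻ x, ENNReal.ofReal ((rad x ^ (2 * p))⁻¹ * profileKernel h p (log (rad x) - s)) ∂μ)
      atBot (𝓝 (L - ∫⁻ x, ENNReal.ofReal ((rad x ^ (2 * p))⁻¹ * (1 - σ x)) ∂μ)) := by
  set f : X → ℝ≥0∞ := fun x => ENNReal.ofReal ((rad x ^ (2 * p))⁻¹ * (1 - σ x)) with hf
  set W := ∫⁻ x, f x ∂μ with hWdef
  set T : ℝ → ℝ≥0∞ := fun t => ∫⁻ x in {x | log (rad x) < t}, f x ∂μ with hT
  have hfm : Measurable f := measurable_inv_pow_mul_one_sub hradm hσm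
  have hWL : W ≤ L := lintegral_inv_pow_mul_one_sub_le hradm hrad hσm hσ0 hσ1 H
  have hWtop : W ≠ ⊤ := ne_top_of_le_ne_top hL hWL
  obtain ⟨B, hB0, hB⟩ := hh.exists_profileKernel_le p
  -- the two-sided estimate, for `s + ε ≤ x₀`
  have key : ∀ s, s + ε ≤ x₀ →
      L - W ≤ ∫⁻ x, ENNReal.ofReal ((rad x ^ (2 * p))⁻¹ * profileKernel h p (log (rad x) - s)) ∂μ ∧
      ∫⁻ x, ENNReal.ofReal ((rad x ^ (2 * p))⁻¹ * profileKernel h p (log (rad x) - s)) ∂μ ≤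
        (L - W) + (1 + ENNReal.ofReal B) * T (s + ε) := by
    intro s hs
    have hhs := hh.translate s
    -- the pieces
    set I₁ := ∫⁻ x, ENNReal.ofReal ((rad x ^ (2 * p))⁻¹ * (h (log (rad x) - s) ^ p * (1 - σ x))) ∂μ
      with hI₁
    set I₂ := ∫⁻ x, ENNReal.ofReal ((rad x ^ (2 * p))⁻¹ *
      (profileKernel h p (log (rad x) - s) * σ x)) ∂μ with hI₂
    set E := ∫⁻ x, ENNReal.ofReal ((rad x ^ (2 * p))⁻¹ *
      (profileKernel h p (log (rad x) - s) * (1 - σ x))) ∂μ with hE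
    have hK : ∀ x, profileKernel (fun y => h (y - s)) p (log (rad x)) =
        profileKernel h p (log (rad x) - s) := fun x => hh.profileKernel_comp_sub p s _
    -- `L = I₁ + I₂`
    have hLsplit : L = I₁ + I₂ := by
      rw [← H _ s ε hε hs hhs, hI₁, hI₂, ← lintegral_add_left
        ((measurable_profileIntegrand_fst hhs hradm hσm))]
      refine lintegral_congr fun x => ?_
      rw [ofReal_profileIntegrand_eq_add hhs hσ0 hσ1 hrad, hK]
    -- `Θ = I₂ + E`
    have hΘsplit : ∫⁻ x, ENNReal.ofReal ((rad x ^ (2 * p))⁻¹ * profileKernel h p (log (rad x) - s)) ∂μ =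
        I₂ + E := by
      rw [hI₂, hE, ← lintegral_add_left]
      · refine lintegral_congr fun x => ?_
        rw [← ENNReal.ofReal_add]
        · congr 1; ring
        · exact mul_nonneg (inv_nonneg.2 (pow_nonneg (hrad x).le _))
            (mul_nonneg (hh.profileKernel_nonneg p _) (hσ0 x))
        · exact mul_nonneg (inv_nonneg.2 (pow_nonneg (hrad x).le _))
            (mul_nonneg (hh.profileKernel_nonneg p _) (by linarith [hσ1 x]))
      · simpa only [hK] using measurable_profileIntegrand_snd (p := p) hhs hradm hσm
    -- `I₁ ≤ W`
    have hI₁W : I₁ ≤ W := lintegral_mono fun x => ENNReal.ofReal_le_ofReal (by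
      simpa only using profileIntegrand_fst_le (p := p) hhs hσ1 hrad x)
    -- `W ≤ I₁ + T (s + ε)`
    have hWI₁ : W ≤ I₁ + T (s + ε) := by
      have hsplit : W = ∫⁻ x in {x | s + ε ≤ log (rad x)}, f x ∂μ + T (s + ε) := by
        rw [hT]
        have hc : {x : X | log (rad x) < s + ε} = {x | s + ε ≤ log (rad x)}ᶜ := by
          ext x; simp [not_le]
        simp only [hc]
        rw [lintegral_add_compl _ (measurableSet_le_log hradm _)]
      rw [hsplit]
      gcongr
      rw [← lintegral_indicator (measurableSet_le_log hradm _)]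
      refine lintegral_mono fun x => ?_
      by_cases hx : x ∈ {x | s + ε ≤ log (rad x)}
      · rw [indicator_of_mem hx, hf]
        simp only
        rw [← profileIntegrand_fst_eq_of_le (p := p) hhs hx]
      · rw [indicator_of_notMem hx]; exact zero_le
    -- `E ≤ B * T (s + ε)`
    have hET : E ≤ ENNReal.ofReal B * T (s + ε) := by
      calc E ≤ ∫⁻ x, ENNReal.ofReal (B * ((rad x ^ (2 * p))⁻¹ * (1 - σ x)) *
              ({x | |log (rad x) - s| < ε} : Set X).indicator (fun _ => (1 : ℝ)) x) ∂μ := by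
            refine lintegral_mono fun x => ENNReal.ofReal_le_ofReal ?_
            have := profileIntegrand_snd_one_sub_le (p := p) hhs hσ1 hrad
              (fun y => by simpa only [hh.profileKernel_comp_sub] using hB (y - s)) x
            simpa only [hK] using this
        _ = ∫⁻ x, ({x | |log (rad x) - s| < ε} : Set X).indicator
              (fun x => ENNReal.ofReal B * f x) x ∂μ := by
            refine lintegral_congr fun x => ?_
            by_cases hx : x ∈ ({x | |log (rad x) - s| < ε} : Set X)
            · rw [indicator_of_mem hx, indicator_of_mem hx, mul_one, ENNReal.ofReal_mul hB0]
            · rw [indicator_of_notMem hx, indicator_of_notMem hx, mul_zero, ENNReal.ofReal_zero]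
        _ = ENNReal.ofReal B * ∫⁻ x in {x | |log (rad x) - s| < ε}, f x ∂μ := by
            have hband : MeasurableSet ({x | |log (rad x) - s| < ε} : Set X) :=
              measurableSet_lt (continuous_abs.measurable.comp
                ((measurable_log.comp hradm).sub_const s)) measurable_const
            rw [lintegral_indicator hband, lintegral_const_mul _ hfm]
        _ ≤ ENNReal.ofReal B * T (s + ε) := by
            gcongr
            exact lintegral_mono_set fun x (hx : |log (rad x) - s| < ε) =>
              show log (rad x) < s + ε by linarith [(abs_lt.1 hx).2]
    -- assemble
    have hI₂eq : I₂ = L - I₁ := by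
      rw [hLsplit, ENNReal.add_sub_cancel_left (ne_top_of_le_ne_top hWtop hI₁W)]
    refine ⟨?_, ?_⟩
    · rw [hΘsplit, hI₂eq]
      exact (tsub_le_tsub_left hI₁W L).trans le_self_add
    · rw [hΘsplit, hI₂eq, add_mul, one_mul, ← add_assoc]
      gcongr
      · calc L - I₁ ≤ L - (W - T (s + ε)) := tsub_le_tsub_left (tsub_le_iff_right.2 hWI₁) L
          _ ≤ L - W + T (s + ε) := tsub_tsub_le_tsub_add
  -- the squeeze
  have hT0 : Tendsto (fun s => (L - W) + (1 + ENNReal.ofReal B) * T (s + ε)) atBot (𝓝 (L - W)) := by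
    have h1 : Tendsto (fun s => T (s + ε)) atBot (𝓝 0) :=
      (tendsto_setLIntegral_inv_pow_mul_one_sub_atBot hradm hσm hWtop).comp
        (tendsto_atBot_add_const_right _ _ tendsto_id)
    have h2 : Tendsto (fun s => (1 + ENNReal.ofReal B) * T (s + ε)) atBot (𝓝 0) := by
      have := ENNReal.Tendsto.const_mul h1 (Or.inr (by simp : (1 + ENNReal.ofReal B) ≠ ⊤))
      simpa using this
    simpa using tendsto_const_nhds.add h2
  refine tendsto_of_tendsto_of_tendsto_of_le_of_le' tendsto_const_nhds hT0 ?_ ?_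
  · filter_upwards [eventually_le_atBot (x₀ - ε)] with s hs using (key s (by linarith)).1
  · filter_upwards [eventually_le_atBot (x₀ - ε)] with s hs using (key s (by linarith)).2

end Main

/-! ### Step 3: the sandwich -/

section Sandwich

variable {h : ℝ → ℝ} {ε : ℝ}

/-- Upper comparison on the kernel's support, integrated:
`∫ ½h^{p-1}h'(log rad - s) dμ ≤ e^{2p(s+ε)} ∫ rad^{-2p} ½h^{p-1}h'(log rad - s) dμ`. [folklore] -/
theorem lintegral_kernel_le_exp_mul (hh : IsProfileTransition h 0 ε) (hrad : ∀ x, 0 < rad x)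
    (s : ℝ) :
    ∫⁻ x, ENNReal.ofReal (profileKernel h p (log (rad x) - s)) ∂μ ≤
      ENNReal.ofReal (exp ((2 * p) * (s + ε))) *
        ∫⁻ x, ENNReal.ofReal ((rad x ^ (2 * p))⁻¹ * profileKernel h p (log (rad x) - s)) ∂μ := by
  rw [← lintegral_const_mul' _ _ ENNReal.ofReal_ne_top]
  refine lintegral_mono fun x => ?_
  rw [← ENNReal.ofReal_mul (exp_pos _).le]
  refine ENNReal.ofReal_le_ofReal ?_
  have h1 := exp_mul_kernel_le (p := p) hh hrad s x
  have h2 : exp ((2 * p) * (s + ε)) * (exp (-(2 * p) * (s + ε)) *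
      profileKernel h p (log (rad x) - s)) = profileKernel h p (log (rad x) - s) := by
    rw [← mul_assoc, ← exp_add]; simp
  calc profileKernel h p (log (rad x) - s)
      = exp ((2 * p) * (s + ε)) * (exp (-(2 * p) * (s + ε)) * profileKernel h p (log (rad x) - s)) :=
        h2.symm
    _ ≤ exp ((2 * p) * (s + ε)) * ((rad x ^ (2 * p))⁻¹ * profileKernel h p (log (rad x) - s)) :=
        mul_le_mul_of_nonneg_left h1 (exp_pos _).le

/-- Lower comparison on the kernel's support, integrated:
`e^{2p(s-ε)} ∫ rad^{-2p} ½h^{p-1}h'(log rad - s) dμ ≤ ∫ ½h^{p-1}h'(log rad - s) dμ`. [folklore] -/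
theorem exp_mul_lintegral_inv_pow_mul_kernel_le (hh : IsProfileTransition h 0 ε)
    (hrad : ∀ x, 0 < rad x) (s : ℝ) :
    ENNReal.ofReal (exp ((2 * p) * (s - ε))) *
        ∫⁻ x, ENNReal.ofReal ((rad x ^ (2 * p))⁻¹ * profileKernel h p (log (rad x) - s)) ∂μ ≤
      ∫⁻ x, ENNReal.ofReal (profileKernel h p (log (rad x) - s)) ∂μ := by
  rw [← lintegral_const_mul' _ _ ENNReal.ofReal_ne_top]
  refine lintegral_mono fun x => ?_
  rw [← ENNReal.ofReal_mul (exp_pos _).le]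
  refine ENNReal.ofReal_le_ofReal ?_
  have h1 := inv_pow_mul_kernel_le (p := p) hh hrad s x
  have h2 : exp ((2 * p) * (s - ε)) * (exp (-(2 * p) * (s - ε)) *
      profileKernel h p (log (rad x) - s)) = profileKernel h p (log (rad x) - s) := by
    rw [← mul_assoc, ← exp_add]; simp
  calc exp ((2 * p) * (s - ε)) * ((rad x ^ (2 * p))⁻¹ * profileKernel h p (log (rad x) - s))
      ≤ exp ((2 * p) * (s - ε)) * (exp (-(2 * p) * (s - ε)) * profileKernel h p (log (rad x) - s)) :=
        mul_le_mul_of_nonneg_left h1 (exp_pos _).le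
    _ = profileKernel h p (log (rad x) - s) := h2

/-- The inner `s`-integral of the translated kernels over a window `[λ₁, λ₀]` is the difference of
the primitive `h^p/(2p)`. [folklore] -/
theorem lintegral_Icc_kernel_eq (hh : IsProfileTransition h 0 ε) (hp : 1 ≤ p) {l₁ l₀ : ℝ}
    (hl : l₁ ≤ l₀) (y : ℝ) :
    ∫⁻ s in Icc l₁ l₀, ENNReal.ofReal (profileKernel h p (y - s)) =
      ENNReal.ofReal (h (y - l₁) ^ p / (2 * p) - h (y - l₀) ^ p / (2 * p)) := by
  have hcont : Continuous fun s => profileKernel h p (y - s) :=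
    (hh.continuous_profileKernel p).comp (continuous_const.sub continuous_id)
  rw [← ofReal_integral_eq_lintegral_ofReal (hcont.integrableOn_Icc)
    (ae_of_all _ fun s => hh.profileKernel_nonneg p _), integral_Icc_eq_integral_Ioc,
    ← intervalIntegral.integral_of_le hl, intervalIntegral.integral_comp_sub_left
      (fun u => profileKernel h p u) y, hh.integral_profileKernel hp]

/-- Bounds for the difference of primitives: it lies in `[0, 1/(2p)]`, vanishes for
`y ≥ λ₀ + ε` and equals `1/(2p)` for `λ₁ + ε ≤ y ≤ λ₀ - ε`. [folklore] -/
theorem primitive_sub_le_indicator (hh : IsProfileTransition h 0 ε) {l₁ l₀ : ℝ} (hl : l₁ ≤ l₀)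
    (y : ℝ) :
    h (y - l₁) ^ p / (2 * p) - h (y - l₀) ^ p / (2 * p) ≤
      (Iio (l₀ + ε)).indicator (fun _ => 1 / (2 * (p : ℝ))) y := by
  by_cases hy : y < l₀ + ε
  · rw [indicator_of_mem (by exact hy)]
    have h1 : h (y - l₁) ^ p / (2 * p) ≤ 1 / (2 * p) := by
      gcongr
      exact pow_le_one₀ (hh.nonneg _) (hh.le_one _)
    have h2 : 0 ≤ h (y - l₀) ^ p / (2 * p) := by
      have := pow_nonneg (hh.nonneg (y - l₀)) p
      positivity
    linarith
  · rw [indicator_of_notMem (by exact hy), hh.eq_one_of_le _ (by linarith),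
      hh.eq_one_of_le _ (by linarith)]
    simp

/-- Lower bound for the difference of primitives by the indicator of the inner window. [folklore] -/
theorem indicator_le_primitive_sub (hh : IsProfileTransition h 0 ε) (hp : 1 ≤ p) {l₁ l₀ : ℝ}
    (hl : l₁ ≤ l₀) (y : ℝ) :
    (Icc (l₁ + ε) (l₀ - ε)).indicator (fun _ => 1 / (2 * (p : ℝ))) y ≤
      h (y - l₁) ^ p / (2 * p) - h (y - l₀) ^ p / (2 * p) := by
  by_cases hy : y ∈ Icc (l₁ + ε) (l₀ - ε)
  · rw [indicator_of_mem hy, hh.eq_one_of_le _ (by linarith [hy.1]),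
      hh.eq_zero_of_le _ (by linarith [hy.2])]
    rcases Nat.exists_eq_add_of_le' (show 0 < p by omega) with ⟨q, rfl⟩; simp
  · rw [indicator_of_notMem hy, sub_nonneg]
    gcongr
    · exact hh.nonneg _
    · exact hh.monotone (by linarith)

/-- **Window estimate, upper**: `∫_{λ₁}^{λ₀} Θ̃(s) ds ≤ (1/2p) μ{log rad < λ₀ + ε}`. [folklore] -/
theorem lintegral_Icc_lintegral_kernel_le [SFinite μ] (hh : IsProfileTransition h 0 ε) (hp : 1 ≤ p)
    (hradm : Measurable rad) {l₁ l₀ : ℝ} (hl : l₁ ≤ l₀) :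
    ∫⁻ s in Icc l₁ l₀, ∫⁻ x, ENNReal.ofReal (profileKernel h p (log (rad x) - s)) ∂μ ≤
      ENNReal.ofReal (1 / (2 * p)) * μ {x | log (rad x) < l₀ + ε} := by
  have hmeas : Measurable (Function.uncurry fun (s : ℝ) (x : X) =>
      ENNReal.ofReal (profileKernel h p (log (rad x) - s))) :=
    ENNReal.measurable_ofReal.comp ((hh.continuous_profileKernel p).measurable.comp
      ((measurable_log.comp (hradm.comp measurable_snd)).sub measurable_fst))
  rw [lintegral_lintegral_swap hmeas.aemeasurable]
  calc ∫⁻ x, ∫⁻ s in Icc l₁ l₀, ENNReal.ofReal (profileKernel h p (log (rad x) - s)) ∂volume ∂μ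
      = ∫⁻ x, ENNReal.ofReal (h (log (rad x) - l₁) ^ p / (2 * p) -
          h (log (rad x) - l₀) ^ p / (2 * p)) ∂μ :=
        lintegral_congr fun x => lintegral_Icc_kernel_eq hh hp hl _
    _ ≤ ∫⁻ x, {x | log (rad x) < l₀ + ε}.indicator (fun _ => ENNReal.ofReal (1 / (2 * p))) x ∂μ := by
        refine lintegral_mono fun x => ?_
        refine (ENNReal.ofReal_le_ofReal (primitive_sub_le_indicator (p := p) hh hl _)).trans ?_
        by_cases hx : log (rad x) < l₀ + ε
        · rw [indicator_of_mem (show log (rad x) ∈ Iio (l₀ + ε) from hx),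
            indicator_of_mem (show x ∈ {x | log (rad x) < l₀ + ε} from hx)]
        · rw [indicator_of_notMem (show log (rad x) ∉ Iio (l₀ + ε) from hx),
            indicator_of_notMem (show x ∉ {x | log (rad x) < l₀ + ε} from hx), ENNReal.ofReal_zero]
    _ = ENNReal.ofReal (1 / (2 * p)) * μ {x | log (rad x) < l₀ + ε} := by
        rw [lintegral_indicator (measurableSet_log_lt hradm _), setLIntegral_const]

/-- **Window estimate, lower**: `(1/2p) μ{λ₁ + ε ≤ log rad ≤ λ₀ - ε} ≤ ∫_{λ₁}^{λ₀} Θ̃(s) ds`.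
[folklore] -/
theorem mul_measure_le_lintegral_Icc_lintegral_kernel [SFinite μ] (hh : IsProfileTransition h 0 ε)
    (hp : 1 ≤ p) (hradm : Measurable rad) {l₁ l₀ : ℝ} (hl : l₁ ≤ l₀) :
    ENNReal.ofReal (1 / (2 * p)) * μ {x | l₁ + ε ≤ log (rad x) ∧ log (rad x) ≤ l₀ - ε} ≤
      ∫⁻ s in Icc l₁ l₀, ∫⁻ x, ENNReal.ofReal (profileKernel h p (log (rad x) - s)) ∂μ := by
  have hmeas : Measurable (Function.uncurry fun (s : ℝ) (x : X) =>
      ENNReal.ofReal (profileKernel h p (log (rad x) - s))) :=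
    ENNReal.measurable_ofReal.comp ((hh.continuous_profileKernel p).measurable.comp
      ((measurable_log.comp (hradm.comp measurable_snd)).sub measurable_fst))
  have hset : MeasurableSet {x | l₁ + ε ≤ log (rad x) ∧ log (rad x) ≤ l₀ - ε} :=
    (measurableSet_le_log hradm _).inter (measurableSet_log_le hradm _)
  rw [lintegral_lintegral_swap hmeas.aemeasurable]
  calc ENNReal.ofReal (1 / (2 * p)) * μ {x | l₁ + ε ≤ log (rad x) ∧ log (rad x) ≤ l₀ - ε}
      = ∫⁻ x, {x | l₁ + ε ≤ log (rad x) ∧ log (rad x) ≤ l₀ - ε}.indicator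
          (fun _ => ENNReal.ofReal (1 / (2 * p))) x ∂μ := by
        rw [lintegral_indicator hset, setLIntegral_const]
    _ ≤ ∫⁻ x, ENNReal.ofReal (h (log (rad x) - l₁) ^ p / (2 * p) -
          h (log (rad x) - l₀) ^ p / (2 * p)) ∂μ := by
        refine lintegral_mono fun x => ?_
        refine le_trans ?_ (ENNReal.ofReal_le_ofReal (indicator_le_primitive_sub (p := p) hh hp hl _))
        by_cases hx : x ∈ {x | l₁ + ε ≤ log (rad x) ∧ log (rad x) ≤ l₀ - ε}
        · rw [indicator_of_mem hx, indicator_of_mem (show log (rad x) ∈ Icc (l₁ + ε) (l₀ - ε) from hx)]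
        · rw [indicator_of_notMem hx]
          exact zero_le
    _ = ∫⁻ x, ∫⁻ s in Icc l₁ l₀, ENNReal.ofReal (profileKernel h p (log (rad x) - s)) ∂volume ∂μ :=
        lintegral_congr fun x => (lintegral_Icc_kernel_eq hh hp hl _).symm

/-- `∫_{λ₁}^{λ₀} e^{2p(s + c)} ds ≤ e^{2p(λ₀ + c)}/(2p)` in `ℝ≥0∞`. [folklore] -/
theorem lintegral_Icc_exp_le (hp : 1 ≤ p) {l₁ l₀ : ℝ} (hl : l₁ ≤ l₀) (c : ℝ) :
    ∫⁻ s in Icc l₁ l₀, ENNReal.ofReal (exp ((2 * p) * (s + c))) ≤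
      ENNReal.ofReal (exp ((2 * p) * (l₀ + c)) / (2 * p)) := by
  have hcont : Continuous fun s : ℝ => exp ((2 * p) * (s + c)) := by fun_prop
  rw [← ofReal_integral_eq_lintegral_ofReal hcont.integrableOn_Icc (ae_of_all _ fun s => (exp_pos _).le),
    integral_Icc_eq_integral_Ioc, ← intervalIntegral.integral_of_le hl]
  refine ENNReal.ofReal_le_ofReal ?_
  have hq : (2 * (p : ℝ)) ≠ 0 := by positivity
  have : ∫ s in l₁..l₀, exp ((2 * p) * (s + c)) =
      (exp ((2 * p) * (l₀ + c)) - exp ((2 * p) * (l₁ + c))) / (2 * p) := by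
    simp_rw [mul_add]
    rw [intervalIntegral.integral_comp_mul_add (fun x => exp x) hq, integral_exp]
    simp [smul_eq_mul, div_eq_inv_mul]
  rw [this]
  have := exp_pos ((2 * p) * (l₁ + c))
  have hq' : (0 : ℝ) < 2 * p := by positivity
  exact div_le_div_of_nonneg_right (by linarith) hq'.le

/-- `∫_{λ₁}^{λ₀} e^{2p(s + c)} ds = (e^{2p(λ₀ + c)} - e^{2p(λ₁ + c)})/(2p)` in `ℝ≥0∞`. [folklore] -/
theorem lintegral_Icc_exp_eq (hp : 1 ≤ p) {l₁ l₀ : ℝ} (hl : l₁ ≤ l₀) (c : ℝ) :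
    ∫⁻ s in Icc l₁ l₀, ENNReal.ofReal (exp ((2 * p) * (s + c))) =
      ENNReal.ofReal ((exp ((2 * p) * (l₀ + c)) - exp ((2 * p) * (l₁ + c))) / (2 * p)) := by
  have hcont : Continuous fun s : ℝ => exp ((2 * p) * (s + c)) := by fun_prop
  rw [← ofReal_integral_eq_lintegral_ofReal hcont.integrableOn_Icc (ae_of_all _ fun s => (exp_pos _).le),
    integral_Icc_eq_integral_Ioc, ← intervalIntegral.integral_of_le hl]
  congr 1
  have hq : (2 * (p : ℝ)) ≠ 0 := by positivity
  simp_rw [mul_add]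
  rw [intervalIntegral.integral_comp_mul_add (fun x => exp x) hq, integral_exp]
  simp [smul_eq_mul, div_eq_inv_mul]

end Sandwich

/-! ### Step 4: bounds for `μ{rad < ρ}` and the limit -/

section Limit

variable {h : ℝ → ℝ} {ε : ℝ}

/-- **Upper bound from the window estimate**: if `Θ(s) ≤ Λ + η` for `s ≤ s⋆`, then for
`λ₀ ≤ s⋆`, `(1/2p) μ{log rad ≤ λ₀ - ε} ≤ (Λ + η) e^{2p(λ₀+ε)}/(2p)`. [folklore] -/
theorem mul_measure_log_le_le [SFinite μ] (hh : IsProfileTransition h 0 ε) (hε : 0 < ε)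
    (hp : 1 ≤ p) (hradm : Measurable rad) (hrad : ∀ x, 0 < rad x) {Λ η : ℝ≥0∞} {sStar : ℝ}
    (hΘ : ∀ s ≤ sStar, ∫⁻ x, ENNReal.ofReal ((rad x ^ (2 * p))⁻¹ *
      profileKernel h p (log (rad x) - s)) ∂μ ≤ Λ + η)
    {l₀ : ℝ} (hl₀ : l₀ ≤ sStar) :
    ENNReal.ofReal (1 / (2 * p)) * μ {x | log (rad x) ≤ l₀ - ε} ≤
      (Λ + η) * ENNReal.ofReal (exp ((2 * p) * (l₀ + ε)) / (2 * p)) := by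
  -- the bound for each window `[l₀ - 2ε - n, l₀]`
  have hwin : ∀ n : ℕ, ENNReal.ofReal (1 / (2 * p)) *
      μ {x | l₀ - 2 * ε - n + ε ≤ log (rad x) ∧ log (rad x) ≤ l₀ - ε} ≤
      (Λ + η) * ENNReal.ofReal (exp ((2 * p) * (l₀ + ε)) / (2 * p)) := by
    intro n
    have hn : (0 : ℝ) ≤ n := n.cast_nonneg
    have hl : l₀ - 2 * ε - n ≤ l₀ := by linarith
    calc ENNReal.ofReal (1 / (2 * p)) *
          μ {x | l₀ - 2 * ε - n + ε ≤ log (rad x) ∧ log (rad x) ≤ l₀ - ε}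
        ≤ ∫⁻ s in Icc (l₀ - 2 * ε - n) l₀, ∫⁻ x, ENNReal.ofReal (profileKernel h p (log (rad x) - s)) ∂μ :=
          mul_measure_le_lintegral_Icc_lintegral_kernel hh hp hradm hl
      _ ≤ ∫⁻ s in Icc (l₀ - 2 * ε - n) l₀, ENNReal.ofReal (exp ((2 * p) * (s + ε))) *
            ∫⁻ x, ENNReal.ofReal ((rad x ^ (2 * p))⁻¹ * profileKernel h p (log (rad x) - s)) ∂μ :=
          setLIntegral_mono' measurableSet_Icc fun s _ => lintegral_kernel_le_exp_mul hh hrad s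
      _ ≤ ∫⁻ s in Icc (l₀ - 2 * ε - n) l₀, ENNReal.ofReal (exp ((2 * p) * (s + ε))) * (Λ + η) :=
          setLIntegral_mono' measurableSet_Icc fun s hs => mul_le_mul_right (hΘ s (hs.2.trans hl₀)) _
      _ = (∫⁻ s in Icc (l₀ - 2 * ε - n) l₀, ENNReal.ofReal (exp ((2 * p) * (s + ε)))) * (Λ + η) :=
          lintegral_mul_const _ (ENNReal.measurable_ofReal.comp (by fun_prop))
      _ ≤ ENNReal.ofReal (exp ((2 * p) * (l₀ + ε)) / (2 * p)) * (Λ + η) :=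
          mul_le_mul_left (lintegral_Icc_exp_le hp hl ε) _
      _ = (Λ + η) * ENNReal.ofReal (exp ((2 * p) * (l₀ + ε)) / (2 * p)) := mul_comm _ _
  -- continuity from below along the windows
  have hmono : Monotone fun n : ℕ => {x : X | l₀ - 2 * ε - n + ε ≤ log (rad x) ∧ log (rad x) ≤ l₀ - ε} := by
    intro n m hnm x hx
    have : (n : ℝ) ≤ m := by exact_mod_cast hnm
    exact ⟨by linarith [hx.1], hx.2⟩
  have hU : (⋃ n : ℕ, {x : X | l₀ - 2 * ε - n + ε ≤ log (rad x) ∧ log (rad x) ≤ l₀ - ε}) =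
      {x | log (rad x) ≤ l₀ - ε} := by
    ext x
    simp only [mem_iUnion, mem_setOf_eq]
    constructor
    · rintro ⟨n, hn⟩; exact hn.2
    · intro hx
      obtain ⟨n, hn⟩ := exists_nat_ge (l₀ - ε - log (rad x))
      exact ⟨n, by linarith, hx⟩
  have hlim := tendsto_measure_iUnion_atTop (μ := μ) hmono
  rw [hU] at hlim
  have hlim' := ENNReal.Tendsto.const_mul hlim (Or.inr (ENNReal.ofReal_ne_top (r := 1 / (2 * p))))
  exact le_of_tendsto' hlim' hwin

/-- **Lower bound from the window estimate**: if `Λ ≤ Θ(s) + η` for `s ≤ s⋆` (`Λ < ∞`), then for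
`λ₀ ≤ s⋆`, `(Λ - η) e^{2p(λ₀-ε)}/(2p) ≤ (1/2p) μ{log rad < λ₀ + ε}`. [folklore] -/
theorem mul_le_mul_measure_log_lt [SFinite μ] (hh : IsProfileTransition h 0 ε)
    (hp : 1 ≤ p) (hradm : Measurable rad) (hrad : ∀ x, 0 < rad x) {Λ η : ℝ≥0∞} (hΛ : Λ ≠ ⊤)
    {sStar : ℝ}
    (hΘ : ∀ s ≤ sStar, Λ ≤ ∫⁻ x, ENNReal.ofReal ((rad x ^ (2 * p))⁻¹ *
      profileKernel h p (log (rad x) - s)) ∂μ + η)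
    {l₀ : ℝ} (hl₀ : l₀ ≤ sStar) :
    ENNReal.ofReal (exp ((2 * p) * (l₀ - ε)) / (2 * p)) * (Λ - η) ≤
      ENNReal.ofReal (1 / (2 * p)) * μ {x | log (rad x) < l₀ + ε} := by
  -- the bound for each window `[l₁, l₀]`
  have hwin : ∀ l₁ ≤ l₀,
      ENNReal.ofReal ((exp ((2 * p) * (l₀ - ε)) - exp ((2 * p) * (l₁ - ε))) / (2 * p)) * (Λ - η) ≤
      ENNReal.ofReal (1 / (2 * p)) * μ {x | log (rad x) < l₀ + ε} := by
    intro l₁ hl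
    calc ENNReal.ofReal ((exp ((2 * p) * (l₀ - ε)) - exp ((2 * p) * (l₁ - ε))) / (2 * p)) * (Λ - η)
        = (∫⁻ s in Icc l₁ l₀, ENNReal.ofReal (exp ((2 * p) * (s + -ε)))) * (Λ - η) := by
          rw [lintegral_Icc_exp_eq hp hl (-ε)]; rfl
      _ = ∫⁻ s in Icc l₁ l₀, ENNReal.ofReal (exp ((2 * p) * (s + -ε))) * (Λ - η) :=
          (lintegral_mul_const _ (ENNReal.measurable_ofReal.comp (by fun_prop))).symm
      _ ≤ ∫⁻ s in Icc l₁ l₀, ENNReal.ofReal (exp ((2 * p) * (s - ε))) *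
            ∫⁻ x, ENNReal.ofReal ((rad x ^ (2 * p))⁻¹ * profileKernel h p (log (rad x) - s)) ∂μ := by
          refine setLIntegral_mono' measurableSet_Icc fun s hs => ?_
          rw [← sub_eq_add_neg]
          exact mul_le_mul_right (tsub_le_iff_right.2 (hΘ s (hs.2.trans hl₀))) _
      _ ≤ ∫⁻ s in Icc l₁ l₀, ∫⁻ x, ENNReal.ofReal (profileKernel h p (log (rad x) - s)) ∂μ :=
          setLIntegral_mono' measurableSet_Icc fun s _ =>
            exp_mul_lintegral_inv_pow_mul_kernel_le hh hrad s
      _ ≤ ENNReal.ofReal (1 / (2 * p)) * μ {x | log (rad x) < l₀ + ε} :=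
          lintegral_Icc_lintegral_kernel_le hh hp hradm hl
  -- let `l₁ → -∞`
  have hq : (0 : ℝ) < 2 * p := by positivity
  have hlim : Tendsto (fun l₁ : ℝ =>
      ENNReal.ofReal ((exp ((2 * p) * (l₀ - ε)) - exp ((2 * p) * (l₁ - ε))) / (2 * p)) * (Λ - η))
      atBot (𝓝 (ENNReal.ofReal (exp ((2 * p) * (l₀ - ε)) / (2 * p)) * (Λ - η))) := by
    refine ENNReal.Tendsto.mul_const (ENNReal.tendsto_ofReal ?_) (Or.inr (ENNReal.sub_ne_top hΛ))
    have h1 : Tendsto (fun l₁ : ℝ => exp ((2 * p) * (l₁ - ε))) atBot (𝓝 0) :=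
      tendsto_exp_atBot.comp ((tendsto_atBot_add_const_right _ (-ε)
        tendsto_id).const_mul_atBot hq)
    have := (tendsto_const_nhds (x := exp ((2 * p) * (l₀ - ε)))).sub h1
    simpa using this.div_const (2 * (p : ℝ))
  exact le_of_tendsto hlim ((eventually_le_atBot l₀).mono hwin)

/-- `exp (2p (log ρ + c)) = ρ^{2p} e^{2pc}` for `ρ > 0`. [folklore] -/
theorem exp_two_mul_log_add {ρ : ℝ} (hρ : 0 < ρ) (c : ℝ) :
    exp ((2 * p) * (log ρ + c)) = ρ ^ (2 * p) * exp ((2 * p) * c) := by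
  rw [mul_add, exp_add, ← rpow_natCast, rpow_def_of_pos hρ]
  push_cast
  ring_nf

/-- **Two-sided bounds for the mass ratio**: for every `t > 0` there is `ρ₀ > 0` with
`(Λ - t) e^{-4pt} ≤ μ{rad < ρ}/ρ^{2p} ≤ (Λ + t) e^{4pt}` for `0 < ρ ≤ ρ₀`, `Λ = L - W`.
[cite: Chirka1989, §15.1] -/
theorem exists_measure_div_pow_mem [SFinite μ] (hradm : Measurable rad) (hrad : ∀ x, 0 < rad x)
    (hσm : Measurable σ) (hσ0 : ∀ x, 0 ≤ σ x) (hσ1 : ∀ x, σ x ≤ 1) (hp : 1 ≤ p) (hL : L ≠ ⊤)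
    (H : ∀ (h : ℝ → ℝ) (s ε : ℝ), 0 < ε → s + ε ≤ x₀ → IsProfileTransition h s ε →
      ∫⁻ x, ENNReal.ofReal ((rad x ^ (2 * p))⁻¹ *
        (h (log (rad x)) ^ p * (1 - σ x) + profileKernel h p (log (rad x)) * σ x)) ∂μ = L)
    {t : ℝ} (ht : 0 < t) :
    ∃ ρ₀ > 0, ∀ ρ ∈ Ioc 0 ρ₀,
      (L - ∫⁻ x, ENNReal.ofReal ((rad x ^ (2 * p))⁻¹ * (1 - σ x)) ∂μ - ENNReal.ofReal t) *
          ENNReal.ofReal (exp (-(4 * p) * t)) ≤ μ {x | rad x < ρ} / ENNReal.ofReal (ρ ^ (2 * p)) ∧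
      μ {x | rad x < ρ} / ENNReal.ofReal (ρ ^ (2 * p)) ≤
        (L - ∫⁻ x, ENNReal.ofReal ((rad x ^ (2 * p))⁻¹ * (1 - σ x)) ∂μ + ENNReal.ofReal t) *
          ENNReal.ofReal (exp ((4 * p) * t)) := by
  set W := ∫⁻ x, ENNReal.ofReal ((rad x ^ (2 * p))⁻¹ * (1 - σ x)) ∂μ with hW
  set Λ := L - W with hΛdef
  have hΛ : Λ ≠ ⊤ := ENNReal.sub_ne_top hL
  obtain ⟨h, hh⟩ := exists_isProfileTransition 0 ht
  have hΘ := tendsto_lintegral_inv_pow_mul_kernel_atBot hradm hrad hσm hσ0 hσ1 hL H hh ht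
  rw [← hW, ← hΛdef] at hΘ
  obtain ⟨sStar, hsStar⟩ := eventually_atBot.1
    ((ENNReal.tendsto_nhds hΛ).1 hΘ (ENNReal.ofReal t) (ENNReal.ofReal_pos.2 ht))
  have hup : ∀ s ≤ sStar, ∫⁻ x, ENNReal.ofReal ((rad x ^ (2 * p))⁻¹ *
      profileKernel h p (log (rad x) - s)) ∂μ ≤ Λ + ENNReal.ofReal t := fun s hs => (hsStar s hs).2
  have hlow : ∀ s ≤ sStar, Λ ≤ ∫⁻ x, ENNReal.ofReal ((rad x ^ (2 * p))⁻¹ *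
      profileKernel h p (log (rad x) - s)) ∂μ + ENNReal.ofReal t :=
    fun s hs => tsub_le_iff_right.1 (hsStar s hs).1
  have hc0 : ENNReal.ofReal (1 / (2 * p)) ≠ 0 := by
    rw [ne_eq, ENNReal.ofReal_eq_zero, not_le]; positivity
  have hq : (0 : ℝ) < 2 * p := by positivity
  refine ⟨exp (sStar - t), exp_pos _, fun ρ hρ => ⟨?_, ?_⟩⟩
  · -- lower bound, `l₀ = log ρ - t`
    have hρ0 := hρ.1
    have hlog : log ρ ≤ sStar - t := by rw [← log_exp (sStar - t)]; exact log_le_log hρ0 hρ.2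
    have hset : {x | rad x < ρ} = {x | log (rad x) < (log ρ - t) + t} := by
      ext x; simp only [mem_setOf_eq, sub_add_cancel]; exact (log_lt_log_iff (hrad x) hρ0).symm
    have key := mul_le_mul_measure_log_lt hh hp hradm hrad hΛ (η := ENNReal.ofReal t) hlow
      (l₀ := log ρ - t) (by linarith)
    rw [← hset, show log ρ - t - t = log ρ + (-(2 * t)) by ring, exp_two_mul_log_add hρ0,
      show ρ ^ (2 * p) * exp ((2 * p) * (-(2 * t))) / (2 * p) =
        (1 / (2 * p)) * (ρ ^ (2 * p) * exp (-(4 * p) * t)) by ring_nf,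
      ENNReal.ofReal_mul (by positivity), mul_assoc, ENNReal.mul_le_mul_iff_right hc0
      ENNReal.ofReal_ne_top, ENNReal.ofReal_mul (by positivity)] at key
    rw [ENNReal.le_div_iff_mul_le (Or.inl (by rw [ne_eq, ENNReal.ofReal_eq_zero, not_le]; positivity))
      (Or.inl ENNReal.ofReal_ne_top)]
    calc (Λ - ENNReal.ofReal t) * ENNReal.ofReal (exp (-(4 * p) * t)) * ENNReal.ofReal (ρ ^ (2 * p))
        = ENNReal.ofReal (ρ ^ (2 * p)) * ENNReal.ofReal (exp (-(4 * p) * t)) * (Λ - ENNReal.ofReal t) := by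
          ring
      _ ≤ μ {x | rad x < ρ} := key
  · -- upper bound, `l₀ = log ρ + t`
    have hρ0 := hρ.1
    have hlog : log ρ ≤ sStar - t := by rw [← log_exp (sStar - t)]; exact log_le_log hρ0 hρ.2
    have hsub : {x | rad x < ρ} ⊆ {x | log (rad x) ≤ (log ρ + t) - t} := fun x (hx : rad x < ρ) => by
      simp only [mem_setOf_eq, add_sub_cancel_right]
      exact (log_lt_log (hrad x) hx).le
    have key := mul_measure_log_le_le hh ht hp hradm hrad (η := ENNReal.ofReal t) hup
      (l₀ := log ρ + t) (by linarith)
    rw [show log ρ + t + t = log ρ + 2 * t by ring, exp_two_mul_log_add hρ0,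
      show ρ ^ (2 * p) * exp ((2 * p) * (2 * t)) / (2 * p) =
        (1 / (2 * p)) * (exp ((4 * p) * t) * ρ ^ (2 * p)) by ring_nf,
      ENNReal.ofReal_mul (by positivity), mul_left_comm, ENNReal.mul_le_mul_iff_right hc0
      ENNReal.ofReal_ne_top, ENNReal.ofReal_mul (by positivity), ← mul_assoc] at key
    exact ENNReal.div_le_of_le_mul ((measure_mono hsub).trans key)

/-- **Density from profile invariance.** Let `μ` be an s-finite measure on `X`,
`rad : X → (0,∞)` and `σ : X → [0,1]` measurable, `p ≥ 1`, and suppose the profile functionals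
`∫ rad^{-2p}(h(log rad)^p(1-σ) + ½h^{p-1}h'(log rad) σ) dμ` all equal the same finite `L`, for
every profile transition `h` located left of `x₀`. Then, with `W = ∫ rad^{-2p}(1-σ) dμ` (`≤ L`),
**`μ{rad < r}/r^{2p} → L - W` as `r → 0⁺`**. For `μ = 𝓗^{2p} ⌞ A` (`A` an analytic set through
`0`, `σ` the tangential fraction) this is the existence of the Lelong number together with
the formula `∫_{B_ρ} [A] ∧ (dd^c g(log|z|))^p = p!2^p (W_ρ + c(p) n(A,0))`.
[cite: Chirka1989, §15.1 Prop. 1 and formula (*)] -/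
theorem tendsto_measure_div_pow_of_profile_invariance [SFinite μ] (hradm : Measurable rad)
    (hrad : ∀ x, 0 < rad x) (hσm : Measurable σ) (hσ0 : ∀ x, 0 ≤ σ x) (hσ1 : ∀ x, σ x ≤ 1)
    (hp : 1 ≤ p) (hL : L ≠ ⊤)
    (H : ∀ (h : ℝ → ℝ) (s ε : ℝ), 0 < ε → s + ε ≤ x₀ → IsProfileTransition h s ε →
      ∫⁻ x, ENNReal.ofReal ((rad x ^ (2 * p))⁻¹ *
        (h (log (rad x)) ^ p * (1 - σ x) + profileKernel h p (log (rad x)) * σ x)) ∂μ = L) :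
    Tendsto (fun r : ℝ => μ {x | rad x < r} / ENNReal.ofReal (r ^ (2 * p))) (𝓝[>] 0)
      (𝓝 (L - ∫⁻ x, ENNReal.ofReal ((rad x ^ (2 * p))⁻¹ * (1 - σ x)) ∂μ)) := by
  set W := ∫⁻ x, ENNReal.ofReal ((rad x ^ (2 * p))⁻¹ * (1 - σ x)) ∂μ with hW
  set Λ := L - W with hΛdef
  have hΛ : Λ ≠ ⊤ := ENNReal.sub_ne_top hL
  have ht0 : Tendsto (fun t : ℝ => ENNReal.ofReal t) (𝓝[>] 0) (𝓝 0) := by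
    have h0 : Tendsto (fun t : ℝ => t) (𝓝[>] (0 : ℝ)) (𝓝 0) :=
      tendsto_nhdsWithin_of_tendsto_nhds tendsto_id
    simpa using ENNReal.tendsto_ofReal h0
  have hexp : ∀ c : ℝ, Tendsto (fun t : ℝ => ENNReal.ofReal (exp (c * t))) (𝓝[>] 0) (𝓝 1) := by
    intro c
    have hc : Continuous fun t : ℝ => exp (c * t) := by fun_prop
    have h1 : Tendsto (fun t : ℝ => exp (c * t)) (𝓝 0) (𝓝 1) := by
      have := hc.tendsto 0
      rwa [mul_zero, exp_zero] at this
    have h2 := ENNReal.tendsto_ofReal (tendsto_nhdsWithin_of_tendsto_nhds (s := Ioi 0) h1)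
    rwa [ENNReal.ofReal_one] at h2
  rw [tendsto_order]
  constructor
  · intro a ha
    have hg : Tendsto (fun t : ℝ => (Λ - ENNReal.ofReal t) * ENNReal.ofReal (exp (-(4 * p) * t)))
        (𝓝[>] 0) (𝓝 Λ) := by
      have h1 : Tendsto (fun t : ℝ => Λ - ENNReal.ofReal t) (𝓝[>] 0) (𝓝 Λ) := by
        have := ENNReal.Tendsto.sub (tendsto_const_nhds (x := Λ)) ht0 (Or.inl hΛ)
        rwa [tsub_zero] at this
      have h2 := ENNReal.Tendsto.mul h1 (Or.inr ENNReal.one_ne_top) (hexp (-(4 * p)))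
        (Or.inl one_ne_zero)
      rwa [mul_one] at h2
    obtain ⟨t, hta, ht⟩ := ((hg.eventually (lt_mem_nhds ha)).and self_mem_nhdsWithin).exists
    obtain ⟨ρ₀, hρ₀, hb⟩ := exists_measure_div_pow_mem hradm hrad hσm hσ0 hσ1 hp hL H ht
    filter_upwards [Ioc_mem_nhdsGT hρ₀] with ρ hρ
    exact hta.trans_le (hb ρ hρ).1
  · intro b hb
    have hg : Tendsto (fun t : ℝ => (Λ + ENNReal.ofReal t) * ENNReal.ofReal (exp ((4 * p) * t)))
        (𝓝[>] 0) (𝓝 Λ) := by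
      have h1 : Tendsto (fun t : ℝ => Λ + ENNReal.ofReal t) (𝓝[>] 0) (𝓝 Λ) := by
        have := (tendsto_const_nhds (x := Λ)).add ht0
        rwa [add_zero] at this
      have h2 := ENNReal.Tendsto.mul h1 (Or.inr ENNReal.one_ne_top) (hexp (4 * p))
        (Or.inl one_ne_zero)
      rwa [mul_one] at h2
    obtain ⟨t, htb, ht⟩ := ((hg.eventually (gt_mem_nhds hb)).and self_mem_nhdsWithin).exists
    obtain ⟨ρ₀, hρ₀, hb'⟩ := exists_measure_div_pow_mem hradm hrad hσm hσ0 hσ1 hp hL H ht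
    filter_upwards [Ioc_mem_nhdsGT hρ₀] with ρ hρ
    exact (hb' ρ hρ).2.trans_lt htb

end Limit

end Literature.Geometry.GeometricMeasureTheory

end
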